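import Summits.QuantumFields.YangMills.Theses.ScalingWindowSplit
import Summits.QuantumFields.YangMills.Theorems.ScalingWindowSplitCurvatureAmnesiaStubUniformOfPointwise
import Summits.QuantumFields.YangMills.Theorems.ScalingWindowSplitCurvatureAmnesiaStubSeparatedTensorsTotal
import HarnessLib

/-!
# `CurvatureAmnesia` from Ward nullity — the funnel of line `WardDefectSketch` (crux stmt-QuantumFields-16192)

Support file for the crux item stmt-QuantumFields-16192 (`CoincidenceRotationBootstrap.CurvatureAmnesia`, shared
verbatim with `ScalingWindowSplit.CurvatureAmnesia`): the kernel-checked reduction of the crux to the ONE open stub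
`stub_wardNullity` (W₀) of the registered line `Cruxes/CurvatureAmnesia/Lines/WardDefectSketch.lean`, its three
support stubs being landed and imported (`stub_angleCalculus`, `stub_separatedTensorsTotal`, `stub_uniformOfPointwise`).

`stub_cruxOfWardNullity : (W₀) → ScalingWindowSplit.CurvatureAmnesia`, where (W₀) — stated VERBATIM as registered on the
item — says: under the crux's hypotheses (weak coupling, OS guards, the Wilson lattice tie, non-triviality, the two gaps),
for every SEPARATED real family `f` (compact, pairwise disjoint supports) the angle-`0` one-insertion lattice Ward functional
`W_k(f) = Σᵢ ⟨Φ_k(f₁) ⋯ Φ_k(L fᵢ) ⋯ Φ_k(f_n)⟩_k` (`L = x₁∂₀ − x₀∂₁`) tends to `0`.  Proof: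
0. the landed `stub_uniformOfPointwise` (tie ⇒ multilinear Banach–Steinhaus on a cut-off family) makes the nullity
   UNIFORM in the angle `θ` for the rotated families `f^θ = f ∘ ρ_θ⁻¹` (`ρ_θ = planeRot 0 θ`);
1. `W_k(θ; f) = −d/dθ ⟨∏ Φ_k(fⱼ^θ)⟩_k` (landed `stub_angleCalculus`) and the mean-value inequality on `[-|θ|, |θ|]` give
   `⟨∏Φ_k(fⱼ^θ)⟩_k − ⟨∏Φ_k(fⱼ)⟩_k → 0` (`sub_tendsto_zero_of_uniform`);
2. the TIE at `f` and at `f^θ` (`IsTensorOf.linActMulti`) identifies the two limits: plane-rotation invariance of the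
   curvature Schwinger functions on separated real tensors (`plane_apply_eq_of_wardNullity`);
3. totality of separated real tensors in `⁰𝒮` (landed `stub_separatedTensorsTotal`) lifts it to `⁰𝒮`
   (`plane_invariant_of_wardNullity`);
4. a Σ5 isometry IS `Q_B⁻¹ ∘ ρ_θ ∘ Q_B` with `cos θ = 3/5`, `sin θ = −4/5` and the proper signed permutation
   `Q_B : e₀ ↔ e₂, e₁ ↔ e₃` (landed `QB_spec`), so proper-hypercubic invariance (twice) finishes
   (`eq_conj_of_sigmaFive`).
No definitions, no notation.  References: Osterwalder–Schrader 1973 §2; folklore.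
-/

noncomputable section

namespace Summit.QuantumFields.YangMills.Cruxes.CurvatureAmnesia.WardDefect

open scoped BigOperators Topology SchwartzMap
open Filter
open Literature.MathematicalPhysics.QuantumLattice Literature.MathematicalPhysics.AQFT
  Literature.MathematicalPhysics.QuantumFieldTheory
open Summit.QuantumFields.YangMills.Theorems.OSLegsFromFemtoAndGap.Upgrade
open Summit.QuantumFields.YangMills.Theorems.PlanarToEuclidean

/-! ## §1 Soft analysis -/

/-- Two complexified real sequences with limits `a`, `b` whose real difference tends to `0` have `a = b`. [folklore] -/
theorem limit_eq_of_sub_tendsto_zero {u v : ℕ → ℝ} {a b : ℂ}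
    (hu : Tendsto (fun k => ((u k : ℝ) : ℂ)) atTop (𝓝 a))
    (hv : Tendsto (fun k => ((v k : ℝ) : ℂ)) atTop (𝓝 b))
    (h0 : Tendsto (fun k => u k - v k) atTop (𝓝 0)) : a = b := by
  have h : Tendsto (fun k => ((u k : ℝ) : ℂ) - ((v k : ℝ) : ℂ)) atTop (𝓝 0) := by
    have h' := (Complex.continuous_ofReal.tendsto 0).comp h0
    rw [Complex.ofReal_zero] at h'
    exact h'.congr fun k => by simp only [Function.comp_apply, Complex.ofReal_sub]
  exact sub_eq_zero.mp (tendsto_nhds_unique (hu.sub hv) h)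

/-- **Mean-value step.**  If every `φ k` has derivative `−W k` everywhere and `W k → 0` uniformly on
`[-|θ|, |θ|]`, then `φ k θ − φ k 0 → 0`. [folklore] -/
theorem sub_tendsto_zero_of_uniform {φ W : ℕ → ℝ → ℝ} (θ : ℝ)
    (hd : ∀ k s, HasDerivAt (φ k) (-(W k s)) s)
    (hU : TendstoUniformlyOn W (fun _ => 0) atTop (Set.Icc (-|θ|) |θ|)) :
    Tendsto (fun k => φ k θ - φ k 0) atTop (𝓝 0) := by
  rw [Metric.tendsto_atTop]
  intro ε hε
  have hε' : 0 < ε / (|θ| + 1) := by positivity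
  obtain ⟨N, hN⟩ := eventually_atTop.1 ((Metric.tendstoUniformlyOn_iff.1 hU) _ hε')
  refine ⟨N, fun k hk => ?_⟩
  have hbound : ∀ s ∈ Set.Icc (-|θ|) |θ|, ‖-(W k s)‖ ≤ ε / (|θ| + 1) := fun s hs => by
    have h := hN k hk s hs
    rw [Real.dist_eq, zero_sub] at h
    exact h.le
  have hmv := Convex.norm_image_sub_le_of_norm_hasDerivWithin_le
    (fun s _ => (hd k s).hasDerivWithinAt) hbound (convex_Icc _ _)
    (⟨by simp, abs_nonneg θ⟩ : (0 : ℝ) ∈ Set.Icc (-|θ|) |θ|) ⟨neg_abs_le θ, le_abs_self θ⟩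
  rw [Real.dist_eq, sub_zero]
  calc |φ k θ - φ k 0| ≤ ε / (|θ| + 1) * ‖θ - 0‖ := hmv
    _ = ε * (|θ| / (|θ| + 1)) := by rw [sub_zero, Real.norm_eq_abs]; ring
    _ < ε * 1 := by
        refine mul_lt_mul_of_pos_left ?_ hε
        rw [div_lt_one (by positivity)]
        exact lt_add_one _
    _ = ε := mul_one ε

/-- At angle `0` nothing is rotated: `(fⱼ ∘ ρ₀⁻¹)ⱼ = f`. [folklore] -/
theorem linActTest_rho_zero_family {n : ℕ} (f : Fin n → 𝓢((EuclideanSpace ℝ (Fin 4)), ℝ)) :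
    (fun j => linActTest (planeRot (d := 3) 0 0) (f j)) = f := by
  funext j
  ext x
  rw [linActTest_apply, rho_symm_apply, neg_zero, planeRot_zero_apply]

/-! ## §2 Plane-rotation amnesia from Ward nullity -/

section Plane

variable {G : Type} [Group G] [TopologicalSpace G] [IsTopologicalGroup G] [CompactSpace G]
  [MeasurableSpace G] [BorelSpace G]

/-- **Plane-rotation amnesia on ONE separated real tensor.**  If the renormalised Wilson correlators of the
all-curvature string converge to `S` on off-diagonal real tensors (the TIE) and the Ward functional of the family `f`
(pairwise disjoint supports) tends to `0` uniformly on compact angle intervals, then `S n (F ∘ ρ_θ⁻¹) = S n F` for the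
tensor `F` of `f` and every `θ`: the lattice difference `⟨∏Φ_k(fⱼ^θ)⟩_k − ⟨∏Φ_k(fⱼ)⟩_k` tends to `0` by the mean-value
step fed the landed angle calculus, and the tie at `f` and at `f^θ` identifies the two limits. [folklore] -/
theorem plane_apply_eq_of_wardNullity (r : LatticeRep G) (sch : SpeciesScheme (YMSpecies G))
    (S : LabelledSchwingerFamily (YMSpecies G) (EuclideanSpace ℝ (Fin 4)))
    (hconv : ∀ (n : ℕ), n ≠ 0 → ∀ (σ : Fin n → YMSpecies G) (f : Fin n → 𝓢((EuclideanSpace ℝ (Fin 4)), ℝ)) (F : 𝓢((Fin n → (EuclideanSpace ℝ (Fin 4))), ℂ)),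
      IsTensorOf F (fun i => ofRealTest (f i)) → IsOffDiagonal F →
        Tendsto (fun k : ℕ => ((latticeSchwinger r.ρ sch (fun s => s.F) k n σ f : ℝ) : ℂ)) atTop (𝓝 (S n σ F)))
    {n : ℕ} {f : Fin n → 𝓢((EuclideanSpace ℝ (Fin 4)), ℝ)}
    (hd : ∀ i j, i ≠ j → Disjoint (tsupport (f i : (EuclideanSpace ℝ (Fin 4)) → ℝ)) (tsupport (f j : (EuclideanSpace ℝ (Fin 4)) → ℝ)))
    (hWf : ∀ Θ : ℝ, TendstoUniformlyOn
      (fun (k : ℕ) (θ : ℝ) => ∑ i : Fin n,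
        latticeSchwinger r.ρ sch (fun s => s.F) k n (fun _ => r.curvature)
          (Function.update (fun j => linActTest (planeRot (d := 3) 0 θ) (f j)) i
            (linActTest (planeRot (d := 3) 0 θ)
              (SchwartzMap.smulLeftCLM ℝ (fun x : (EuclideanSpace ℝ (Fin 4)) => x 1)
                  (LineDeriv.lineDerivOp (EuclideanSpace.single (0 : Fin 4) (1 : ℝ) : (EuclideanSpace ℝ (Fin 4))) (f i)) -
                SchwartzMap.smulLeftCLM ℝ (fun x : (EuclideanSpace ℝ (Fin 4)) => x 0)
                  (LineDeriv.lineDerivOp (EuclideanSpace.single (1 : Fin 4) (1 : ℝ) : (EuclideanSpace ℝ (Fin 4))) (f i))))))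
      (fun _ => 0) atTop (Set.Icc (-Θ) Θ))
    (θ : ℝ) {F : 𝓢((Fin n → (EuclideanSpace ℝ (Fin 4))), ℂ)} (hF : IsTensorOf F fun i => ofRealTest (f i)) :
    S n (fun _ => r.curvature) (linActMulti (planeRot (d := 3) 0 θ) F) = S n (fun _ => r.curvature) F := by
  rcases Nat.eq_zero_or_pos n with rfl | hn
  · -- no points: nothing to rotate
    have h : linActMulti (planeRot (d := 3) 0 θ) F = F := by
      ext x
      simp only [linActMulti_apply]
      congr 1
      funext i
      exact isEmptyElim i
    rw [h]
  · have hod : IsOffDiagonal F := isOffDiagonal_of_disjoint_tsupport hd hF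
    -- the TIE at `f` and at the rotated family `f^θ` (whose tensor is `linActMulti (ρ θ) F`)
    have h1 := hconv n hn.ne' (fun _ => r.curvature) f F hF hod
    have h2 := hconv n hn.ne' (fun _ => r.curvature) (fun j => linActTest (planeRot (d := 3) 0 θ) (f j))
      (linActMulti (planeRot (d := 3) 0 θ) F) (hF.linActMulti _) (isOffDiagonal_linActMulti _ hod)
    -- angle calculus (landed) + uniform Ward nullity: the lattice difference tends to `0`
    have h0 := sub_tendsto_zero_of_uniform θ
      (fun k s => stub_angleCalculus G r sch k n f s) (hWf |θ|)
    simp only [linActTest_rho_zero_family] at h0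
    exact limit_eq_of_sub_tendsto_zero h2 h1 h0

/-- **Plane-rotation amnesia on `⁰𝒮` from Ward nullity on every separated family**: totality of the separated real
tensors (landed `stub_separatedTensorsTotal`) applied to the continuous functionals `(S n σ) ∘ linActMulti (ρ θ)` and
`S n σ`, `σ` the all-curvature string. [folklore] -/
theorem plane_invariant_of_wardNullity (r : LatticeRep G) (sch : SpeciesScheme (YMSpecies G))
    (S : LabelledSchwingerFamily (YMSpecies G) (EuclideanSpace ℝ (Fin 4)))
    (hconv : ∀ (n : ℕ), n ≠ 0 → ∀ (σ : Fin n → YMSpecies G) (f : Fin n → 𝓢((EuclideanSpace ℝ (Fin 4)), ℝ)) (F : 𝓢((Fin n → (EuclideanSpace ℝ (Fin 4))), ℂ)),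
      IsTensorOf F (fun i => ofRealTest (f i)) → IsOffDiagonal F →
        Tendsto (fun k : ℕ => ((latticeSchwinger r.ρ sch (fun s => s.F) k n σ f : ℝ) : ℂ)) atTop (𝓝 (S n σ F)))
    (hW : ∀ (n : ℕ) (f : Fin n → 𝓢((EuclideanSpace ℝ (Fin 4)), ℝ)),
      ((∀ i, HasCompactSupport (f i : (EuclideanSpace ℝ (Fin 4)) → ℝ)) ∧
        ∀ i j, i ≠ j → Disjoint (tsupport (f i : (EuclideanSpace ℝ (Fin 4)) → ℝ)) (tsupport (f j : (EuclideanSpace ℝ (Fin 4)) → ℝ))) →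
      ∀ Θ : ℝ, TendstoUniformlyOn
        (fun (k : ℕ) (θ : ℝ) => ∑ i : Fin n,
          latticeSchwinger r.ρ sch (fun s => s.F) k n (fun _ => r.curvature)
            (Function.update (fun j => linActTest (planeRot (d := 3) 0 θ) (f j)) i
              (linActTest (planeRot (d := 3) 0 θ)
                (SchwartzMap.smulLeftCLM ℝ (fun x : (EuclideanSpace ℝ (Fin 4)) => x 1)
                    (LineDeriv.lineDerivOp (EuclideanSpace.single (0 : Fin 4) (1 : ℝ) : (EuclideanSpace ℝ (Fin 4))) (f i)) -
                  SchwartzMap.smulLeftCLM ℝ (fun x : (EuclideanSpace ℝ (Fin 4)) => x 0)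
                    (LineDeriv.lineDerivOp (EuclideanSpace.single (1 : Fin 4) (1 : ℝ) : (EuclideanSpace ℝ (Fin 4))) (f i))))))
        (fun _ => 0) atTop (Set.Icc (-Θ) Θ))
    (θ : ℝ) (n : ℕ) (F : 𝓢((Fin n → (EuclideanSpace ℝ (Fin 4))), ℂ)) (hF : IsOffDiagonal F) :
    S n (fun _ => r.curvature) (linActMulti (planeRot (d := 3) 0 θ) F) = S n (fun _ => r.curvature) F := by
  refine stub_separatedTensorsTotal n ((S n fun _ => r.curvature).comp (linActMulti (planeRot (d := 3) 0 θ)))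
    (S n fun _ => r.curvature) ?_ F hF
  intro f hf F' hF'
  exact plane_apply_eq_of_wardNullity r sch S hconv hf.2 (hW n f hf) θ hF'

end Plane

/-! ## §3 Geometry: a Σ5 isometry is a conjugate of a `(x₀,x₁)`-rotation by `Q_B` -/

/-- A Σ5 isometry (`R e₀ = e₀`, `R e₁ = e₁`, `R e₂ = (3e₂+4e₃)/5`, `R e₃ = (−4e₂+3e₃)/5`) IS the conjugate
`x ↦ Q⁻¹ (ρ_θ (Q x))` (`Q.trans ((ρ θ).trans Q.symm)`) of the `(x₀,x₁)`-rotation by `θ` (`cos θ = 3/5`,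
`sin θ = −4/5`) by any isometry `Q : e₀ ↦ e₂, e₁ ↦ e₃, e₂ ↦ e₀, e₃ ↦ e₁`: both agree on the axis basis. [folklore] -/
theorem eq_conj_of_sigmaFive (R : (EuclideanSpace ℝ (Fin 4)) ≃ₗᵢ[ℝ] (EuclideanSpace ℝ (Fin 4)))
    (hR0 : R (EuclideanSpace.single 0 1) = EuclideanSpace.single 0 1)
    (hR1 : R (EuclideanSpace.single 1 1) = EuclideanSpace.single 1 1)
    (hR2 : R (EuclideanSpace.single 2 1) =
      (3/5 : ℝ) • EuclideanSpace.single 2 1 + (4/5 : ℝ) • EuclideanSpace.single 3 1)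
    (hR3 : R (EuclideanSpace.single 3 1) =
      -((4/5 : ℝ) • EuclideanSpace.single 2 1) + (3/5 : ℝ) • EuclideanSpace.single 3 1)
    {θ : ℝ} (hc : Real.cos θ = 3 / 5) (hs : Real.sin θ = -(4 / 5)) (Q : (EuclideanSpace ℝ (Fin 4)) ≃ₗᵢ[ℝ] (EuclideanSpace ℝ (Fin 4)))
    (hQ0 : Q (EuclideanSpace.single 0 1) = EuclideanSpace.single 2 1)
    (hQ1 : Q (EuclideanSpace.single 1 1) = EuclideanSpace.single 3 1)
    (hQ2 : Q (EuclideanSpace.single 2 1) = EuclideanSpace.single 0 1)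
    (hQ3 : Q (EuclideanSpace.single 3 1) = EuclideanSpace.single 1 1) :
    R = Q.trans ((planeRot (d := 3) 0 θ).trans Q.symm) := by
  have hQs0 : Q.symm (EuclideanSpace.single 0 1) = EuclideanSpace.single 2 1 := by
    rw [← hQ2, LinearIsometryEquiv.symm_apply_apply]
  have hQs1 : Q.symm (EuclideanSpace.single 1 1) = EuclideanSpace.single 3 1 := by
    rw [← hQ3, LinearIsometryEquiv.symm_apply_apply]
  have hQs2 : Q.symm (EuclideanSpace.single 2 1) = EuclideanSpace.single 0 1 := by
    rw [← hQ0, LinearIsometryEquiv.symm_apply_apply]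
  have hQs3 : Q.symm (EuclideanSpace.single 3 1) = EuclideanSpace.single 1 1 := by
    rw [← hQ1, LinearIsometryEquiv.symm_apply_apply]
  set R' : (EuclideanSpace ℝ (Fin 4)) ≃ₗᵢ[ℝ] (EuclideanSpace ℝ (Fin 4)) := Q.trans ((planeRot (d := 3) 0 θ).trans Q.symm) with hR'
  have h0' : R' (EuclideanSpace.single 0 1) = EuclideanSpace.single 0 1 := by
    rw [hR', LinearIsometryEquiv.trans_apply, LinearIsometryEquiv.trans_apply, hQ0, rho_e2, hQs2]
  have h1' : R' (EuclideanSpace.single 1 1) = EuclideanSpace.single 1 1 := by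
    rw [hR', LinearIsometryEquiv.trans_apply, LinearIsometryEquiv.trans_apply, hQ1, rho_e3, hQs3]
  have h2' : R' (EuclideanSpace.single 2 1) =
      (3 / 5 : ℝ) • EuclideanSpace.single 2 1 + (4 / 5 : ℝ) • EuclideanSpace.single 3 1 := by
    rw [hR', LinearIsometryEquiv.trans_apply, LinearIsometryEquiv.trans_apply, hQ2, rho_e0, map_add,
      map_smul, map_smul, hQs0, hQs1, hc, hs, neg_neg]
  have h3' : R' (EuclideanSpace.single 3 1) =
      -((4 / 5 : ℝ) • EuclideanSpace.single 2 1) + (3 / 5 : ℝ) • EuclideanSpace.single 3 1 := by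
    rw [hR', LinearIsometryEquiv.trans_apply, LinearIsometryEquiv.trans_apply, hQ3, rho_e1, map_add,
      map_smul, map_smul, hQs0, hQs1, hc, hs, neg_smul]
  have hlin : (R.toLinearEquiv : (EuclideanSpace ℝ (Fin 4)) →ₗ[ℝ] (EuclideanSpace ℝ (Fin 4))) = (R'.toLinearEquiv : (EuclideanSpace ℝ (Fin 4)) →ₗ[ℝ] (EuclideanSpace ℝ (Fin 4))) := by
    refine (EuclideanSpace.basisFun (Fin 4) ℝ).toBasis.ext fun i => ?_
    simp only [OrthonormalBasis.coe_toBasis, EuclideanSpace.basisFun_apply, LinearEquiv.coe_coe,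
      LinearIsometryEquiv.coe_toLinearEquiv]
    fin_cases i
    · exact hR0.trans h0'.symm
    · exact hR1.trans h1'.symm
    · exact hR2.trans h2'.symm
    · exact hR3.trans h3'.symm
  exact LinearIsometryEquiv.ext fun x => LinearMap.congr_fun hlin x

/-- An isometry `Q : e₀ ↦ e₂, e₁ ↦ e₃, e₂ ↦ e₀, e₃ ↦ e₁` maps axes to axes (the signed-permutation clause of the
proper-hypercubic guard). [folklore] -/
theorem axes_of_swap (Q : (EuclideanSpace ℝ (Fin 4)) ≃ₗᵢ[ℝ] (EuclideanSpace ℝ (Fin 4)))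
    (hQ0 : Q (EuclideanSpace.single 0 1) = EuclideanSpace.single 2 1)
    (hQ1 : Q (EuclideanSpace.single 1 1) = EuclideanSpace.single 3 1)
    (hQ2 : Q (EuclideanSpace.single 2 1) = EuclideanSpace.single 0 1)
    (hQ3 : Q (EuclideanSpace.single 3 1) = EuclideanSpace.single 1 1) :
    ∀ i : Fin 4, ∃ j : Fin 4, Q (EuclideanSpace.single i 1) = EuclideanSpace.single j 1 ∨
      Q (EuclideanSpace.single i 1) = -EuclideanSpace.single j 1 := by
  intro i
  fin_cases i
  · exact ⟨2, Or.inl hQ0⟩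
  · exact ⟨3, Or.inl hQ1⟩
  · exact ⟨0, Or.inl hQ2⟩
  · exact ⟨1, Or.inl hQ3⟩

/-! ## §4 The crux from Ward nullity -/

/-- **`CurvatureAmnesia` (route `ScalingWindowSplit`, item stmt-QuantumFields-16192) from WARD NULLITY** — the registered
hard stub `stub_wardNullity` (W₀) of line `WardDefectSketch`, stated verbatim as the hypothesis: under the crux's
hypotheses, for every separated real family the angle-`0` one-insertion lattice Ward functional
`Σᵢ ⟨Φ_k(f₁) ⋯ Φ_k(L fᵢ) ⋯ Φ_k(f_n)⟩_k` tends to `0`.  The landed `stub_uniformOfPointwise` (tie ⇒ multilinear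
Banach–Steinhaus) upgrades it to nullity uniform in the rotation angle for the rotated families; plane-rotation amnesia on
`⁰𝒮` at the angle `θ` with `cos θ = 3/5`, `sin θ = −4/5` (`plane_invariant_of_wardNullity`), conjugated by the proper
signed permutation `Q_B` (landed `QB_spec`; the proper-hypercubic guard used for `Q_B` and `Q_B⁻¹`), is the Σ5 clause
(`eq_conj_of_sigmaFive`, `linActMulti_trans_eq`).  Registered on the item as the composition stub `stub_cruxOfWardNullity`;
the `CoincidenceRotationBootstrap` copy of the crux is definitionally equal and follows by the same term. -/
theorem stub_cruxOfWardNullity :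
    (∀ (G : Type) [Group G] [TopologicalSpace G] [IsTopologicalGroup G] [CompactSpace G] [MeasurableSpace G]
      [BorelSpace G], IsCompactSimpleLieGroup G →
        ∀ (r : LatticeRep G) (sch : SpeciesScheme (YMSpecies G))
          (S : LabelledSchwingerFamily (YMSpecies G) (EuclideanSpace ℝ (Fin 4))),
          sch.HasWeakCouplingLimit →
            (S.IsNormalized ∧ S.IsHermitian ∧ S.HasLinearGrowth ∧ S.IsReflectionPositive ∧ S.IsSymmetric ∧
              S.HasClusterProperty ∧
              (∀ (n : ℕ) (k : Fin n → YMSpecies G) (a : EuclideanSpace ℝ (Fin 4))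
                (F : 𝓢((Fin n → EuclideanSpace ℝ (Fin 4)), ℂ)), IsOffDiagonal F →
                  S n k (translateMulti a F) = S n k F) ∧
              (∀ (n : ℕ) (k : Fin n → YMSpecies G)
                (R : EuclideanSpace ℝ (Fin 4) ≃ₗᵢ[ℝ] EuclideanSpace ℝ (Fin 4)),
                LinearMap.det (R.toLinearEquiv : EuclideanSpace ℝ (Fin 4) →ₗ[ℝ] EuclideanSpace ℝ (Fin 4)) = 1 →
                (∀ i : Fin 4, ∃ j : Fin 4, R (EuclideanSpace.single i 1) = EuclideanSpace.single j 1 ∨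
                  R (EuclideanSpace.single i 1) = -EuclideanSpace.single j 1) →
                ∀ F : 𝓢((Fin n → EuclideanSpace ℝ (Fin 4)), ℂ), IsOffDiagonal F →
                  S n k (linActMulti R F) = S n k F)) →
            (∀ (n : ℕ), n ≠ 0 → ∀ (σ : Fin n → YMSpecies G) (f : Fin n → 𝓢(EuclideanSpace ℝ (Fin 4), ℝ))
              (F : 𝓢((Fin n → EuclideanSpace ℝ (Fin 4)), ℂ)),
              IsTensorOf F (fun i => ofRealTest (f i)) → IsOffDiagonal F →
                Tendsto (fun k : ℕ => ((latticeSchwinger r.ρ sch (fun s => s.F) k n σ f : ℝ) : ℂ)) atTop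
                  (𝓝 (S n σ F))) →
            (∃ (F₁ G₁ : 𝓢((Fin 1 → EuclideanSpace ℝ (Fin 4)), ℂ))
                (H₁ : 𝓢((Fin (1 + 1) → EuclideanSpace ℝ (Fin 4)), ℂ)),
              IsTimeOrdered F₁ ∧ IsTimeOrdered G₁ ∧ IsAppendTensorOf H₁ (osAdjoint F₁) G₁ ∧
                S (1 + 1) (fun _ => r.curvature) H₁ ≠
                  S 1 (fun _ => r.curvature) (osAdjoint F₁) * S 1 (fun _ => r.curvature) G₁) →
            (∃ Δ : ℝ, 0 < Δ ∧ S.HasMassGap Δ ∧ HasLatticeMassGap r sch Δ) →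
              ∀ (n : ℕ) (f : Fin n → 𝓢(EuclideanSpace ℝ (Fin 4), ℝ)),
                ((∀ i, HasCompactSupport (f i : EuclideanSpace ℝ (Fin 4) → ℝ)) ∧
                  ∀ i j, i ≠ j → Disjoint (tsupport (f i : EuclideanSpace ℝ (Fin 4) → ℝ))
                    (tsupport (f j : EuclideanSpace ℝ (Fin 4) → ℝ))) →
                Tendsto
                  (fun k : ℕ => ∑ i : Fin n,
                    latticeSchwinger r.ρ sch (fun s => s.F) k n (fun _ => r.curvature)
                      (Function.update f i
                        (SchwartzMap.smulLeftCLM ℝ (fun x : EuclideanSpace ℝ (Fin 4) => x 1)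
                            (LineDeriv.lineDerivOp (EuclideanSpace.single (0 : Fin 4) (1 : ℝ) :
                              EuclideanSpace ℝ (Fin 4)) (f i)) -
                          SchwartzMap.smulLeftCLM ℝ (fun x : EuclideanSpace ℝ (Fin 4) => x 0)
                            (LineDeriv.lineDerivOp (EuclideanSpace.single (1 : Fin 4) (1 : ℝ) :
                              EuclideanSpace ℝ (Fin 4)) (f i)))))
                  atTop (𝓝 0)) →
      Summit.QuantumFields.YangMills.Theses.ScalingWindowSplit.CurvatureAmnesia := by
  intro hW G _ _ _ _ hG
  letI : MeasurableSpace G := borel G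
  haveI : BorelSpace G := ⟨rfl⟩
  intro r sch S hWk hax hconv hNT hgap R hR n F₀ hF₀
  have hhyp := hax.2.2.2.2.2.2.2
  obtain ⟨hR0, hR1, hR2, hR3⟩ := hR
  obtain ⟨θ, hc, hs⟩ := exists_cos_eq_and_sin_eq_neg (a := 3 / 5) (b := 4 / 5) (by norm_num)
  obtain ⟨hQdet, hQ0, hQ1, hQ2, hQ3⟩ := QB_spec
  set Q : (EuclideanSpace ℝ (Fin 4)) ≃ₗᵢ[ℝ] (EuclideanSpace ℝ (Fin 4)) :=
    ((Submodule.reflection (Submodule.span ℝ {((EuclideanSpace.single (0 : Fin 4) (1 : ℝ) : (EuclideanSpace ℝ (Fin 4))) -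
        EuclideanSpace.single (2 : Fin 4) (1 : ℝ))})ᗮ : (EuclideanSpace ℝ (Fin 4)) ≃ₗᵢ[ℝ] (EuclideanSpace ℝ (Fin 4))).trans
      (Submodule.reflection (Submodule.span ℝ {((EuclideanSpace.single (1 : Fin 4) (1 : ℝ) : (EuclideanSpace ℝ (Fin 4))) -
        EuclideanSpace.single (3 : Fin 4) (1 : ℝ))})ᗮ : (EuclideanSpace ℝ (Fin 4)) ≃ₗᵢ[ℝ] (EuclideanSpace ℝ (Fin 4)))) with hQ
  have hRconj : R = Q.trans ((planeRot (d := 3) 0 θ).trans Q.symm) :=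
    eq_conj_of_sigmaFive R hR0 hR1 hR2 hR3 hc hs Q hQ0 hQ1 hQ2 hQ3
  -- proper-hypercubic invariance for `Q` and `Q⁻¹`
  have hQax := axes_of_swap Q hQ0 hQ1 hQ2 hQ3
  have hQs0 : Q.symm (EuclideanSpace.single 0 1) = EuclideanSpace.single 2 1 := by
    rw [← hQ2, LinearIsometryEquiv.symm_apply_apply]
  have hQs1 : Q.symm (EuclideanSpace.single 1 1) = EuclideanSpace.single 3 1 := by
    rw [← hQ3, LinearIsometryEquiv.symm_apply_apply]
  have hQs2 : Q.symm (EuclideanSpace.single 2 1) = EuclideanSpace.single 0 1 := by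
    rw [← hQ0, LinearIsometryEquiv.symm_apply_apply]
  have hQs3 : Q.symm (EuclideanSpace.single 3 1) = EuclideanSpace.single 1 1 := by
    rw [← hQ1, LinearIsometryEquiv.symm_apply_apply]
  have hQsax := axes_of_swap Q.symm hQs0 hQs1 hQs2 hQs3
  have hinvQ : ∀ (m : ℕ) (F : 𝓢((Fin m → (EuclideanSpace ℝ (Fin 4))), ℂ)), IsOffDiagonal F →
      S m (fun _ => r.curvature) (linActMulti Q F) = S m (fun _ => r.curvature) F :=
    fun m F hF => hhyp m (fun _ => r.curvature) Q hQdet hQax F hF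
  have hinvQs : ∀ (m : ℕ) (F : 𝓢((Fin m → (EuclideanSpace ℝ (Fin 4))), ℂ)), IsOffDiagonal F →
      S m (fun _ => r.curvature) (linActMulti Q.symm F) = S m (fun _ => r.curvature) F :=
    fun m F hF => hhyp m (fun _ => r.curvature) Q.symm (det_symm hQdet) hQsax F hF
  -- Ward nullity of THIS `(G, r, sch, S)`, made uniform in the angle by the landed `stub_uniformOfPointwise`
  have hWu := stub_uniformOfPointwise G r sch S hconv (hW G hG r sch S hWk hax hconv hNT hgap)
  -- plane-rotation amnesia on `⁰𝒮` at the angle `θ`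
  have hplane := plane_invariant_of_wardNullity r sch S hconv hWu θ
  rw [hRconj, linActMulti_trans_eq, linActMulti_trans_eq,
    hinvQs n _ (isOffDiagonal_linActMulti _ (isOffDiagonal_linActMulti _ hF₀)),
    hplane n _ (isOffDiagonal_linActMulti _ hF₀), hinvQ n _ hF₀]

end Summit.QuantumFields.YangMills.Cruxes.CurvatureAmnesia.WardDefect

end
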